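import Summits.NavierStokesRegularity.NavierStokesRegularity.Theses.RecurrentProfiles
import Summits.NavierStokesRegularity.NavierStokesRegularity.Theses.SqueezeCycle
import Summits.NavierStokesRegularity.NavierStokesRegularity.Theorems.RecurrentProfilesRecurrentLiouvilleFrNoInvariantClusterPoint
import Summits.NavierStokesRegularity.NavierStokesRegularity.Theorems.RecurrentProfilesRecurrentLiouvilleLebL3BackwardLiouville
import Summits.NavierStokesRegularity.NavierStokesRegularity.Theorems.RecurrentProfilesRecurrentLiouvilleLebL3FinalRegularity
import Summits.NavierStokesRegularity.NavierStokesRegularity.Theorems.RecurrentProfilesRecurrentLiouvilleLebSubcriticalBackward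
import Summits.NavierStokesRegularity.NavierStokesRegularity.Theorems.RecurrentProfilesRecurrentLiouvilleLebSupercriticalFinal
import HarnessLib

/-!
# Crux `RecurrentLiouville` (stmt-NavierStokesRegularity-1589), line `Sketch` v8 (Lebesgue rungs):
# certificate (the bet is the crux) and the Lebesgue portrait of a Type-I singularity model

Registered stub `stub_lebCertificate` of skeleton v8 (lead c10).  With the four Lebesgue rungs landed —
S1 `stub_lebL3BackwardLiouville` (Albritton–Barker 2019 Thm 1.2 in the class, p154632), S2
`stub_lebL3FinalRegularity` (Seregin 2012 `L³` criterion in the class, p155198), S3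
`stub_lebSubcriticalBackward` (`1 ≤ q < 3`, p155997), S4 `stub_lebSupercriticalFinal` (`3 < q < ∞`,
p156426) — this file records:

* `recurrentLiouville_of_lebBet` / `lebBet_of_recurrentLiouville` / `lebBet_iff_recurrentLiouville`: the
  skeleton's bet ("uniformly recurrent class members DARK to the four rungs are regular") is EQUIVALENT to
  the crux (⇒ by the four rungs and a case split; ⇐ by vacuity).  So skeleton v8 is complete modulo the
  crux itself, exactly as v5–v7 were (Disproof §E1 shape); the bet is not claimed easier.
* `lebesguePortrait_of_singular` (recurrence-free): a Type-I singularity model — a suitable weak solution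
  on `ℝ³ × ℝ₋` with weak gradient, `𝐈 < ⊤`, rate `C/√(−t)`, backward-singular origin — has
  `‖u(t)‖_{L³(ℝ³)}` essentially unbounded on EVERY half-line `(−∞, T₀)` AND on every final interval
  `(T₀, 0)`; `‖u(t)‖_{L^q}` essentially unbounded on every `(−∞, T₀)` for every `1 ≤ q < 3` (for
  `q = 2`: infinite kinetic energy in the far past, `energyUnbounded_of_singular`); and `‖u(t)‖_{L^q}`
  essentially unbounded on every `(T₀, 0)` for every `3 < q < ∞`.  For `q = 3` this is the two-sided
  extension of the Nečas–Růžička–Šverák / Tsai `U ∈ L³` exclusion from self-similar to all Type-I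
  profiles (`l3Unbounded_twoSided_of_singular`).  Clauses for `Negative/CounterexamplePortrait`
  successors and for DSS/RSS-hunting negative routes (a `λ`-DSS candidate profile `U(·,s)` must have
  `‖U(s)‖_{L³} = ∞` for a non-null set of phases `s`, and infinite energy).

## References

* D. Albritton, T. Barker, J. Math. Fluid Mech. 21 (2019) no. 43 = arXiv:1811.00502, Thm 1.2. [AlbrittonBarker2019]
* G. Seregin, Comm. Math. Phys. 312 (2012) 833–845, Thm 1.1. [Seregin2012CMP]
* J. Nečas, M. Růžička, V. Šverák, Acta Math. 176 (1996) 283–294, Thm 1. [NecasRuzickaSverak1996]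
* T.-P. Tsai, Arch. Rational Mech. Anal. 143 (1998) 29–51, Thm 1. [Tsai1998]
-/

noncomputable section

-- the sub-problem namespace repeats the summit name (D-0017 layout `Summit.<S>.<P>.Theorems`)
set_option linter.dupNamespace false

namespace Summit.NavierStokesRegularity.NavierStokesRegularity.Theorems

open MeasureTheory Set Function Filter Topology TopologicalSpace Metric
open Literature.Analysis Literature.Analysis.FluidPDE
open scoped NNReal ENNReal

/-! ## The bet is the crux -/

/-- **The crux from the bet.**  If uniformly recurrent class members dark to the four Lebesgue rungs are
regular, the crux holds: a uniformly recurrent class member either meets one of the rungs — backward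
`L³` (S1, then it vanishes a.e.), final `L³` (S2), subcritical backward `L^q` (S3), supercritical final
`L^q` (S4) — or it is dark to all four. [cite: AlbrittonBarker2019, Thm 1.2] -/
theorem recurrentLiouville_of_lebBet
    (hB : ∀ (C : ℝ) (u : ℝ → EuclideanSpace ℝ (Fin 3) → EuclideanSpace ℝ (Fin 3))
      (p : ℝ → EuclideanSpace ℝ (Fin 3) → ℝ)
      (G : ℝ → EuclideanSpace ℝ (Fin 3) → EuclideanSpace ℝ (Fin 3) →L[ℝ] EuclideanSpace ℝ (Fin 3)),
      IsSuitableWeakSolutionOn (slab (EuclideanSpace ℝ (Fin 3)) (Iio 0) isOpen_Iio) 1 0 u p →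
      HasWeakSpatialGradientOn (slab (EuclideanSpace ℝ (Fin 3)) (Iio 0) isOpen_Iio) u G →
      typeIBound (Iio (0 : ℝ) ×ˢ univ) u p G < ⊤ →
      HasTypeITimeDecay C u →
      (∀ ε : ℝ, 0 < ε → ∀ K : Set (ℝ × EuclideanSpace ℝ (Fin 3)), IsCompact K →
        K ⊆ Set.Iic (0 : ℝ) ×ˢ Set.univ → ∃ L : ℝ, 0 < L ∧ ∀ a : ℝ, ∃ σ ∈ Set.Icc a (a + L),
          eLpNorm (fun z : ℝ × EuclideanSpace ℝ (Fin 3) =>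
            nsRescale (Real.exp σ) u z.1 z.2 - u z.1 z.2) 3 (volume.restrict K) ≤
              ENNReal.ofReal ε) →
      ¬ (∃ (M : ℝ≥0∞) (T₀ : ℝ), M < ⊤ ∧
          ∀ᵐ t ∂(volume : Measure ℝ), t < T₀ → eLpNorm (u t) 3 volume ≤ M) →
      ¬ (∃ (M : ℝ≥0∞) (T₀ : ℝ), M < ⊤ ∧ T₀ < 0 ∧
          ∀ᵐ t ∂(volume : Measure ℝ), T₀ < t → t < 0 → eLpNorm (u t) 3 volume ≤ M) →
      (∀ q : ℝ≥0∞, 1 ≤ q → q < 3 → ¬ (∃ (E : ℝ≥0∞) (T₀ : ℝ), E < ⊤ ∧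
          ∀ᵐ t ∂(volume : Measure ℝ), t < T₀ → eLpNorm (u t) q volume ≤ E)) →
      (∀ q : ℝ≥0∞, 3 < q → q < ⊤ → ¬ (∃ (E : ℝ≥0∞) (T₀ : ℝ), E < ⊤ ∧ T₀ < 0 ∧
          ∀ᵐ t ∂(volume : Measure ℝ), T₀ < t → t < 0 → eLpNorm (u t) q volume ≤ E)) →
      ¬ IsBackwardSingularPoint u 0) :
    Theses.RecurrentProfiles.RecurrentLiouville := by
  intro u p G C hsw hwg hI hdec hrec
  by_cases h1 : (∃ (M : ℝ≥0∞) (T₀ : ℝ), M < ⊤ ∧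
          ∀ᵐ t ∂(volume : Measure ℝ), t < T₀ → eLpNorm (u t) 3 volume ≤ M)
  · exact frNoInvariantClusterPoint_not_singular_of_ae_zero
      (stub_lebL3BackwardLiouville C u p G hsw hwg hI hdec h1)
  by_cases h2 : (∃ (M : ℝ≥0∞) (T₀ : ℝ), M < ⊤ ∧ T₀ < 0 ∧
          ∀ᵐ t ∂(volume : Measure ℝ), T₀ < t → t < 0 → eLpNorm (u t) 3 volume ≤ M)
  · exact stub_lebL3FinalRegularity C u p G hsw hwg hI hdec h2
  by_cases h3 : ∃ q : ℝ≥0∞, 1 ≤ q ∧ q < 3 ∧ (∃ (E : ℝ≥0∞) (T₀ : ℝ), E < ⊤ ∧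
          ∀ᵐ t ∂(volume : Measure ℝ), t < T₀ → eLpNorm (u t) q volume ≤ E)
  · obtain ⟨q, hq1, hq3, hE⟩ := h3
    exact stub_lebSubcriticalBackward q hq1 hq3 C u p G hsw hwg hI hdec hE
  by_cases h4 : ∃ q : ℝ≥0∞, 3 < q ∧ q < ⊤ ∧ (∃ (E : ℝ≥0∞) (T₀ : ℝ), E < ⊤ ∧ T₀ < 0 ∧
          ∀ᵐ t ∂(volume : Measure ℝ), T₀ < t → t < 0 → eLpNorm (u t) q volume ≤ E)
  · obtain ⟨q, hq3, hqt, hE⟩ := h4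
    exact stub_lebSupercriticalFinal q hq3 hqt C u p G hsw hwg hI hdec hE
  · exact hB C u p G hsw hwg hI hdec hrec h1 h2
      (fun q hq1 hq3 hE => h3 ⟨q, hq1, hq3, hE⟩) (fun q hq3 hqt hE => h4 ⟨q, hq3, hqt, hE⟩)

/-- **The bet from the crux** (vacuity: under the crux every uniformly recurrent class member is
regular, dark or not). -/
theorem lebBet_of_recurrentLiouville (hcrux : Theses.RecurrentProfiles.RecurrentLiouville) :
    ∀ (C : ℝ) (u : ℝ → EuclideanSpace ℝ (Fin 3) → EuclideanSpace ℝ (Fin 3))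
      (p : ℝ → EuclideanSpace ℝ (Fin 3) → ℝ)
      (G : ℝ → EuclideanSpace ℝ (Fin 3) → EuclideanSpace ℝ (Fin 3) →L[ℝ] EuclideanSpace ℝ (Fin 3)),
      IsSuitableWeakSolutionOn (slab (EuclideanSpace ℝ (Fin 3)) (Iio 0) isOpen_Iio) 1 0 u p →
      HasWeakSpatialGradientOn (slab (EuclideanSpace ℝ (Fin 3)) (Iio 0) isOpen_Iio) u G →
      typeIBound (Iio (0 : ℝ) ×ˢ univ) u p G < ⊤ →
      HasTypeITimeDecay C u →
      (∀ ε : ℝ, 0 < ε → ∀ K : Set (ℝ × EuclideanSpace ℝ (Fin 3)), IsCompact K →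
        K ⊆ Set.Iic (0 : ℝ) ×ˢ Set.univ → ∃ L : ℝ, 0 < L ∧ ∀ a : ℝ, ∃ σ ∈ Set.Icc a (a + L),
          eLpNorm (fun z : ℝ × EuclideanSpace ℝ (Fin 3) =>
            nsRescale (Real.exp σ) u z.1 z.2 - u z.1 z.2) 3 (volume.restrict K) ≤
              ENNReal.ofReal ε) →
      ¬ (∃ (M : ℝ≥0∞) (T₀ : ℝ), M < ⊤ ∧
          ∀ᵐ t ∂(volume : Measure ℝ), t < T₀ → eLpNorm (u t) 3 volume ≤ M) →
      ¬ (∃ (M : ℝ≥0∞) (T₀ : ℝ), M < ⊤ ∧ T₀ < 0 ∧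
          ∀ᵐ t ∂(volume : Measure ℝ), T₀ < t → t < 0 → eLpNorm (u t) 3 volume ≤ M) →
      (∀ q : ℝ≥0∞, 1 ≤ q → q < 3 → ¬ (∃ (E : ℝ≥0∞) (T₀ : ℝ), E < ⊤ ∧
          ∀ᵐ t ∂(volume : Measure ℝ), t < T₀ → eLpNorm (u t) q volume ≤ E)) →
      (∀ q : ℝ≥0∞, 3 < q → q < ⊤ → ¬ (∃ (E : ℝ≥0∞) (T₀ : ℝ), E < ⊤ ∧ T₀ < 0 ∧
          ∀ᵐ t ∂(volume : Measure ℝ), T₀ < t → t < 0 → eLpNorm (u t) q volume ≤ E)) →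
      ¬ IsBackwardSingularPoint u 0 :=
  fun C u p G hsw hwg hI hdec hrec _ _ _ _ => hcrux u p G C hsw hwg hI hdec hrec

/-! ## The Lebesgue portrait of a Type-I singularity model (recurrence-free) -/

/-- **Lebesgue portrait of a Type-I singularity model.**  A suitable weak solution `(u,p)` on
`ℝ³ × ℝ₋` with weak gradient `G`, `𝐈 < ⊤`, the rate `C` and a backward-singular origin has: `L³`
slices essentially unbounded on every half-line `(−∞, T₀)` (Albritton–Barker Thm 1.2) and on every
final interval `(T₀, 0)` (Seregin 2012); `L^q` slices, `1 ≤ q < 3`, essentially unbounded on every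
`(−∞, T₀)`; `L^q` slices, `3 < q < ∞`, essentially unbounded on every `(T₀, 0)`.  No recurrence is
assumed. [cite: AlbrittonBarker2019, Thm 1.2; Seregin2012CMP, Thm 1.1] -/
theorem lebesguePortrait_of_singular {C : ℝ}
    {u : ℝ → EuclideanSpace ℝ (Fin 3) → EuclideanSpace ℝ (Fin 3)}
    {p : ℝ → EuclideanSpace ℝ (Fin 3) → ℝ}
    {G : ℝ → EuclideanSpace ℝ (Fin 3) → EuclideanSpace ℝ (Fin 3) →L[ℝ] EuclideanSpace ℝ (Fin 3)}
    (hsw : IsSuitableWeakSolutionOn (slab (EuclideanSpace ℝ (Fin 3)) (Iio 0) isOpen_Iio) 1 0 u p)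
    (hwg : HasWeakSpatialGradientOn (slab (EuclideanSpace ℝ (Fin 3)) (Iio 0) isOpen_Iio) u G)
    (hI : typeIBound (Iio (0 : ℝ) ×ˢ univ) u p G < ⊤) (hdec : HasTypeITimeDecay C u)
    (hsing : IsBackwardSingularPoint u 0) :
    (∀ (M : ℝ≥0∞) (T₀ : ℝ), M < ⊤ →
        ¬ (∀ᵐ t ∂(volume : Measure ℝ), t < T₀ → eLpNorm (u t) 3 volume ≤ M)) ∧
    (∀ (M : ℝ≥0∞) (T₀ : ℝ), M < ⊤ → T₀ < 0 →
        ¬ (∀ᵐ t ∂(volume : Measure ℝ), T₀ < t → t < 0 → eLpNorm (u t) 3 volume ≤ M)) ∧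
    (∀ q : ℝ≥0∞, 1 ≤ q → q < 3 → ∀ (E : ℝ≥0∞) (T₀ : ℝ), E < ⊤ →
        ¬ (∀ᵐ t ∂(volume : Measure ℝ), t < T₀ → eLpNorm (u t) q volume ≤ E)) ∧
    (∀ q : ℝ≥0∞, 3 < q → q < ⊤ → ∀ (E : ℝ≥0∞) (T₀ : ℝ), E < ⊤ → T₀ < 0 →
        ¬ (∀ᵐ t ∂(volume : Measure ℝ), T₀ < t → t < 0 → eLpNorm (u t) q volume ≤ E)) := by
  refine ⟨fun M T₀ hM h => ?_, fun M T₀ hM hT₀ h => ?_, fun q hq1 hq3 E T₀ hE h => ?_,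
    fun q hq3 hqt E T₀ hE hT₀ h => ?_⟩
  · exact frNoInvariantClusterPoint_not_singular_of_ae_zero
      (stub_lebL3BackwardLiouville C u p G hsw hwg hI hdec ⟨M, T₀, hM, h⟩) hsing
  · exact stub_lebL3FinalRegularity C u p G hsw hwg hI hdec ⟨M, T₀, hM, hT₀, h⟩ hsing
  · exact stub_lebSubcriticalBackward q hq1 hq3 C u p G hsw hwg hI hdec ⟨E, T₀, hE, h⟩ hsing
  · exact stub_lebSupercriticalFinal q hq3 hqt C u p G hsw hwg hI hdec ⟨E, T₀, hE, hT₀, h⟩ hsing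

/-- **Two-sided `L³` law** (the `q = 3` clauses): at a Type-I singularity model, `‖u(t)‖_{L³(ℝ³)}` is
essentially unbounded both as `t → −∞` (on every `(−∞,T₀)`) and as `t → 0⁻` (on every `(T₀,0)`) —
the Nečas–Růžička–Šverák / Tsai `U ∈ L³` exclusion extended from self-similar to all Type-I profiles.
[cite: NecasRuzickaSverak1996, Thm 1; AlbrittonBarker2019, Thm 1.2; Seregin2012CMP, Thm 1.1] -/
theorem l3Unbounded_twoSided_of_singular {C : ℝ}
    {u : ℝ → EuclideanSpace ℝ (Fin 3) → EuclideanSpace ℝ (Fin 3)}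
    {p : ℝ → EuclideanSpace ℝ (Fin 3) → ℝ}
    {G : ℝ → EuclideanSpace ℝ (Fin 3) → EuclideanSpace ℝ (Fin 3) →L[ℝ] EuclideanSpace ℝ (Fin 3)}
    (hsw : IsSuitableWeakSolutionOn (slab (EuclideanSpace ℝ (Fin 3)) (Iio 0) isOpen_Iio) 1 0 u p)
    (hwg : HasWeakSpatialGradientOn (slab (EuclideanSpace ℝ (Fin 3)) (Iio 0) isOpen_Iio) u G)
    (hI : typeIBound (Iio (0 : ℝ) ×ˢ univ) u p G < ⊤) (hdec : HasTypeITimeDecay C u)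
    (hsing : IsBackwardSingularPoint u 0) {M : ℝ≥0∞} (hM : M < ⊤) {T₀ : ℝ} (hT₀ : T₀ < 0) :
    ¬ (∀ᵐ t ∂(volume : Measure ℝ), t < T₀ → eLpNorm (u t) 3 volume ≤ M) ∧
    ¬ (∀ᵐ t ∂(volume : Measure ℝ), T₀ < t → t < 0 → eLpNorm (u t) 3 volume ≤ M) :=
  ⟨(lebesguePortrait_of_singular hsw hwg hI hdec hsing).1 M T₀ hM,
    (lebesguePortrait_of_singular hsw hwg hI hdec hsing).2.1 M T₀ hM hT₀⟩

/-- **Infinite energy in the far past** (the `q = 2` clause): a Type-I singularity model has kinetic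
energy `‖u(t)‖²_{L²(ℝ³)}` essentially unbounded on every half-line `(−∞, T₀)` — Leray's finite-energy
backward scenario is excluded throughout the Albritton–Barker class (zoom-out + persistence + the Chae
rung). [cite: AlbrittonBarker2019, Lemma 2.2, Prop. 2.3] -/
theorem energyUnbounded_of_singular {C : ℝ}
    {u : ℝ → EuclideanSpace ℝ (Fin 3) → EuclideanSpace ℝ (Fin 3)}
    {p : ℝ → EuclideanSpace ℝ (Fin 3) → ℝ}
    {G : ℝ → EuclideanSpace ℝ (Fin 3) → EuclideanSpace ℝ (Fin 3) →L[ℝ] EuclideanSpace ℝ (Fin 3)}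
    (hsw : IsSuitableWeakSolutionOn (slab (EuclideanSpace ℝ (Fin 3)) (Iio 0) isOpen_Iio) 1 0 u p)
    (hwg : HasWeakSpatialGradientOn (slab (EuclideanSpace ℝ (Fin 3)) (Iio 0) isOpen_Iio) u G)
    (hI : typeIBound (Iio (0 : ℝ) ×ˢ univ) u p G < ⊤) (hdec : HasTypeITimeDecay C u)
    (hsing : IsBackwardSingularPoint u 0) {E : ℝ≥0∞} (hE : E < ⊤) (T₀ : ℝ) :
    ¬ (∀ᵐ t ∂(volume : Measure ℝ), t < T₀ → eLpNorm (u t) 2 volume ≤ E) :=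
  (lebesguePortrait_of_singular hsw hwg hI hdec hsing).2.2.1 2 (by norm_num) (by norm_num) E T₀ hE

/-! ## Registered stub: certificate ∧ portrait -/

/-- **Registered stub `stub_lebCertificate`** (skeleton v8, lead c10): the bet ⟺ the crux, and the
Lebesgue portrait of a Type-I singularity model. [cite: AlbrittonBarker2019, Thm 1.2; Seregin2012CMP, Thm 1.1] -/
theorem stub_lebCertificate :
    ((∀ (C : ℝ) (u : ℝ → EuclideanSpace ℝ (Fin 3) → EuclideanSpace ℝ (Fin 3))
      (p : ℝ → EuclideanSpace ℝ (Fin 3) → ℝ)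
      (G : ℝ → EuclideanSpace ℝ (Fin 3) → EuclideanSpace ℝ (Fin 3) →L[ℝ] EuclideanSpace ℝ (Fin 3)),
      IsSuitableWeakSolutionOn (slab (EuclideanSpace ℝ (Fin 3)) (Iio 0) isOpen_Iio) 1 0 u p →
      HasWeakSpatialGradientOn (slab (EuclideanSpace ℝ (Fin 3)) (Iio 0) isOpen_Iio) u G →
      typeIBound (Iio (0 : ℝ) ×ˢ univ) u p G < ⊤ →
      HasTypeITimeDecay C u →
      (∀ ε : ℝ, 0 < ε → ∀ K : Set (ℝ × EuclideanSpace ℝ (Fin 3)), IsCompact K →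
        K ⊆ Set.Iic (0 : ℝ) ×ˢ Set.univ → ∃ L : ℝ, 0 < L ∧ ∀ a : ℝ, ∃ σ ∈ Set.Icc a (a + L),
          eLpNorm (fun z : ℝ × EuclideanSpace ℝ (Fin 3) =>
            nsRescale (Real.exp σ) u z.1 z.2 - u z.1 z.2) 3 (volume.restrict K) ≤
              ENNReal.ofReal ε) →
      ¬ (∃ (M : ℝ≥0∞) (T₀ : ℝ), M < ⊤ ∧
          ∀ᵐ t ∂(volume : Measure ℝ), t < T₀ → eLpNorm (u t) 3 volume ≤ M) →
      ¬ (∃ (M : ℝ≥0∞) (T₀ : ℝ), M < ⊤ ∧ T₀ < 0 ∧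
          ∀ᵐ t ∂(volume : Measure ℝ), T₀ < t → t < 0 → eLpNorm (u t) 3 volume ≤ M) →
      (∀ q : ℝ≥0∞, 1 ≤ q → q < 3 → ¬ (∃ (E : ℝ≥0∞) (T₀ : ℝ), E < ⊤ ∧
          ∀ᵐ t ∂(volume : Measure ℝ), t < T₀ → eLpNorm (u t) q volume ≤ E)) →
      (∀ q : ℝ≥0∞, 3 < q → q < ⊤ → ¬ (∃ (E : ℝ≥0∞) (T₀ : ℝ), E < ⊤ ∧ T₀ < 0 ∧
          ∀ᵐ t ∂(volume : Measure ℝ), T₀ < t → t < 0 → eLpNorm (u t) q volume ≤ E)) →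
      ¬ IsBackwardSingularPoint u 0) ↔ Theses.RecurrentProfiles.RecurrentLiouville) ∧
    (∀ (C : ℝ) (u : ℝ → EuclideanSpace ℝ (Fin 3) → EuclideanSpace ℝ (Fin 3))
      (p : ℝ → EuclideanSpace ℝ (Fin 3) → ℝ)
      (G : ℝ → EuclideanSpace ℝ (Fin 3) → EuclideanSpace ℝ (Fin 3) →L[ℝ] EuclideanSpace ℝ (Fin 3)),
      IsSuitableWeakSolutionOn (slab (EuclideanSpace ℝ (Fin 3)) (Iio 0) isOpen_Iio) 1 0 u p →
      HasWeakSpatialGradientOn (slab (EuclideanSpace ℝ (Fin 3)) (Iio 0) isOpen_Iio) u G →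
      typeIBound (Iio (0 : ℝ) ×ˢ univ) u p G < ⊤ →
      HasTypeITimeDecay C u →
      IsBackwardSingularPoint u 0 →
      (∀ (M : ℝ≥0∞) (T₀ : ℝ), M < ⊤ →
          ¬ (∀ᵐ t ∂(volume : Measure ℝ), t < T₀ → eLpNorm (u t) 3 volume ≤ M)) ∧
      (∀ (M : ℝ≥0∞) (T₀ : ℝ), M < ⊤ → T₀ < 0 →
          ¬ (∀ᵐ t ∂(volume : Measure ℝ), T₀ < t → t < 0 → eLpNorm (u t) 3 volume ≤ M)) ∧
      (∀ q : ℝ≥0∞, 1 ≤ q → q < 3 → ∀ (E : ℝ≥0∞) (T₀ : ℝ), E < ⊤ →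
          ¬ (∀ᵐ t ∂(volume : Measure ℝ), t < T₀ → eLpNorm (u t) q volume ≤ E)) ∧
      (∀ q : ℝ≥0∞, 3 < q → q < ⊤ → ∀ (E : ℝ≥0∞) (T₀ : ℝ), E < ⊤ → T₀ < 0 →
          ¬ (∀ᵐ t ∂(volume : Measure ℝ), T₀ < t → t < 0 → eLpNorm (u t) q volume ≤ E))) :=
  ⟨⟨recurrentLiouville_of_lebBet, lebBet_of_recurrentLiouville⟩,
    fun _ _ _ _ hsw hwg hI hdec hsing => lebesguePortrait_of_singular hsw hwg hI hdec hsing⟩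

/-- The certificate in the SqueezeCycle copy of the crux (the two route copies agree, `Iff.rfl`). -/
theorem lebBet_iff_recurrentLiouville' :
    Theses.RecurrentProfiles.RecurrentLiouville ↔ Theses.SqueezeCycle.RecurrentLiouville := Iff.rfl

end Summit.NavierStokesRegularity.NavierStokesRegularity.Theorems

end
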